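import Literature.AlgebraicGeometry.Hu2025.Proofs.S01S09Interface.GammaQuadHu22SetupTorsor
import Literature.AlgebraicGeometry.Hu2025.Proofs.S01S09Interface.SplitTorusLaurent
import Literature.AlgebraicGeometry.Hu2025.Proofs.S01S09Interface.GammaQuadTorusFree
import HarnessLib

/-!
# Hu 2022 p.132 l.30–51 AS TYPED (row 110 g `Hu22P132L30`): the (β)-inhabitant `S_quad_torus` SATISFIES the printed
# trivialisation claim (9.4) — `Hu22P132L30 S_quad_torus.toHu22Setup`, with ONE open set and the split torus `𝔾⁸_m`
# (joint J1 / GAP-LEDGER-HU row HU-R01 — OURS; nothing of the sources asserted)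

**HONEST FRAMING (D-0012/D-0089).** [Hu2025] (arXiv:2507.21400v1) / [Hu2022] (arXiv:2203.03842v4) are unrefereed preprints under
adjudication; nothing of them is asserted. Row 110 g (`R110gSetupPrinted`, res-type-024) types [Hu22] p.132 l.30–51 («`π : Gr_d →
Gr̄_d (≅ U)` is a principal `(𝔾ⁿ_m/𝔾_m)`-bundle … (9.4) `Gr_d|_O ≅ O × (𝔾ⁿ_m/𝔾_m)` … `𝔾^{n−1}_m`») as the CLAIM `Hu22P132L30 S` over the
literal record `Hu22Setup`: a finite open cover `O_j` of `U` and isomorphisms `quot⁻¹(O_j) ≅ splitTorusOver (n−1) O_j` OVER `O_j`.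
THIS FILE proves that claim for the (β)-reading inhabitant `S_quad_torus` (`GammaQuadHu22SetupTorus`: `X = U = X_quad =
Gr_d/(𝔾⁹_m/𝔾_m)`, `quot = quotX` the torus normalisation), with the ONE-element cover `{⊤}`: `hu22P132L30_torus`. Ingredients: the
torsor isomorphism `cellIsoLaurent : cell ≅ Spec((Rh ⧸ J)[t^±])` over `X_quad` (`GammaQuadHu22SetupTorsor`, from
`S03Pluecker/GammaQuadTorusTorsor.torsorEquiv`), the generic bridge `SplitTorus.specLaurentIso` (`Spec R[t^±] ≅ splitTorusOver k
(Spec R)`), and the transport of `splitTorusOver` along the isomorphism `U|_⊤ ≅ X_quad` (`SplitTorus.transport`). So for this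
inhabitant the printed (a)-datum «`π` the quotient map, a (trivial) `𝔾^{n−1}_m`-torsor» holds in the record's OWN typed shape; what it
still does not carry is «positive integer `r`» / `U` open in `X × 𝔸^r` (`r = 0` here) and «`X` of finite type over Spec ℤ» (said so).
OURS kernel statements about the typed carriers; nothing of [Hu25]/[Hu22] asserted. AI proof is weaker than expert review.
-/

noncomputable section

open _root_.CategoryTheory _root_.AlgebraicGeometry

namespace Literature.AlgebraicGeometry.Hu2025.Statements.S01S09Interface

/-! ## Generic: transporting the split torus along an isomorphism of bases -/

namespace SplitTorus

variable {O O' : Scheme.{0}} (j : O' ≅ O) (k : ℕ)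

/-- `𝔸(Fin k; O') ≅ 𝔸(Fin k; O)` induced by `j : O' ≅ O`. OURS plumbing.
[cite: Hu2025, Thm. 9.4 p.161; [Hu22] p.132 l.43–51; joint J1 = GAP-LEDGER-HU row HU-R01 (unrefereed preprints under adjudication, D-0012/D-0089 — generic plumbing for OUR typed records of row 110 g/h; nothing of the sources asserted)] -/
def affineMapIso : 𝔸(Fin k; O') ≅ 𝔸(Fin k; O) where
  hom := AffineSpace.map (Fin k) j.hom
  inv := AffineSpace.map (Fin k) j.inv
  hom_inv_id := by rw [← AffineSpace.map_comp, j.hom_inv_id, AffineSpace.map_id]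
  inv_hom_id := by rw [← AffineSpace.map_comp, j.inv_hom_id, AffineSpace.map_id]

/-- The split torus pulls back to the split torus under `𝔸(map j)`.
[cite: Hu2025, Thm. 9.4 p.161; [Hu22] p.132 l.43–51; joint J1 = GAP-LEDGER-HU row HU-R01 (unrefereed preprints under adjudication, D-0012/D-0089 — generic plumbing for OUR typed records of row 110 g/h; nothing of the sources asserted)] -/
theorem preimage_splitTorusOver_map :
    (AffineSpace.map (Fin k) j.hom) ⁻¹ᵁ (splitTorusOver k O) = splitTorusOver k O' := by
  rw [splitTorusOver, Scheme.preimage_basicOpen, splitTorusOver]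
  congr 1
  show (AffineSpace.map (Fin k) j.hom).appTop (∏ i : Fin k, AffineSpace.coord O i) = _
  rw [map_prod]
  exact Finset.prod_congr rfl fun i _ => AffineSpace.map_appTop_coord j.hom i

/-- The range of `splitTorusOver k O' ↪ 𝔸(Fin k; O') ≅ 𝔸(Fin k; O)` is `splitTorusOver k O`.
[cite: Hu2025, Thm. 9.4 p.161; [Hu22] p.132 l.43–51; joint J1 = GAP-LEDGER-HU row HU-R01 (unrefereed preprints under adjudication, D-0012/D-0089 — generic plumbing for OUR typed records of row 110 g/h; nothing of the sources asserted)] -/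
theorem range_ι_map :
    Set.range ⇑((splitTorusOver k O').ι ≫ AffineSpace.map (Fin k) j.hom) =
      ((splitTorusOver k O : (𝔸(Fin k; O)).Opens) : Set _) := by
  have hc : ⇑((splitTorusOver k O').ι ≫ AffineSpace.map (Fin k) j.hom) =
      ⇑(AffineSpace.map (Fin k) j.hom) ∘ ⇑(splitTorusOver k O').ι :=
    funext fun x => Scheme.Hom.comp_apply _ _ x
  rw [hc, Set.range_comp, Scheme.Opens.range_ι, ← preimage_splitTorusOver_map j k, Scheme.Hom.coe_preimage,
    Set.image_preimage_eq]
  exact (affineMapIso j k).hom.homeomorph.surjective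

/-- **Transport of the split torus along `j : O' ≅ O`**: `splitTorusOver k O' ≅ splitTorusOver k O`. OURS plumbing.
[cite: Hu2025, Thm. 9.4 p.161; [Hu22] p.132 l.43–51; joint J1 = GAP-LEDGER-HU row HU-R01 (unrefereed preprints under adjudication, D-0012/D-0089 — generic plumbing for OUR typed records of row 110 g/h; nothing of the sources asserted)] -/
def transport : ((splitTorusOver k O' : (𝔸(Fin k; O')).Opens) : Scheme.{0}) ≅
    ((splitTorusOver k O : (𝔸(Fin k; O)).Opens) : Scheme.{0}) :=
  haveI : IsIso (AffineSpace.map (Fin k) j.hom) := inferInstanceAs (IsIso (affineMapIso j k).hom)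
  IsOpenImmersion.isoOfRangeEq ((splitTorusOver k O').ι ≫ AffineSpace.map (Fin k) j.hom) (splitTorusOver k O).ι
    (by rw [range_ι_map, Scheme.Opens.range_ι])

/-- `transport.hom ≫ proj_O = proj_{O'} ≫ j.hom`.
[cite: Hu2025, Thm. 9.4 p.161; [Hu22] p.132 l.43–51; joint J1 = GAP-LEDGER-HU row HU-R01 (unrefereed preprints under adjudication, D-0012/D-0089 — generic plumbing for OUR typed records of row 110 g/h; nothing of the sources asserted)] -/
theorem transport_hom_proj :
    (transport j k).hom ≫ splitTorusOverProj k O = splitTorusOverProj k O' ≫ j.hom := by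
  haveI : IsIso (AffineSpace.map (Fin k) j.hom) := inferInstanceAs (IsIso (affineMapIso j k).hom)
  have h : (transport j k).hom ≫ (splitTorusOver k O).ι = (splitTorusOver k O').ι ≫ AffineSpace.map (Fin k) j.hom :=
    IsOpenImmersion.isoOfRangeEq_hom_fac _ _ _
  rw [splitTorusOverProj, ← Category.assoc, h, Category.assoc, AffineSpace.map_over, splitTorusOverProj, Category.assoc]

end SplitTorus

/-! ## The (β)-inhabitant satisfies `Hu22P132L30` -/

namespace Torus

open S03Pluecker S07GammaSchemes S08MainTheorem

/-- The literal record underlying `S_quad_torus`. OURS abbreviation.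
[cite: Hu2025, [Hu22] p.131 l.4–41, p.132 l.30–51; joint J1 = GAP-LEDGER-HU row HU-R01 (unrefereed preprints under adjudication, D-0012/D-0089 — kernel statement about OUR typed records; nothing of the sources asserted)] -/
abbrev Sq : Hu22Setup ℚ 9 quadHuMatroid := S_quad_torus.toHu22Setup

/-- `U` of the record as a scheme: `↑(⊤ : 𝔸(Fin 0; X_quad).Opens)`. OURS abbreviation.
[cite: Hu2025, [Hu22] p.131 l.6–9; joint J1 = GAP-LEDGER-HU row HU-R01 (unrefereed preprints under adjudication, D-0012/D-0089 — kernel statement about OUR typed records; nothing of the sources asserted)] -/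
abbrev W : Scheme.{0} := ((⊤ : (𝔸(Fin 0; X_quad)).Opens) : Scheme.{0})

/-- The identification `U ⟶ X_quad` (`⊤ ↪ 𝔸⁰_{X_quad} → X_quad`), an isomorphism. OURS plumbing.
[cite: Hu2025, [Hu22] p.131 l.6–9; joint J1 = GAP-LEDGER-HU row HU-R01 (unrefereed preprints under adjudication, D-0012/D-0089 — kernel statement about OUR typed records; nothing of the sources asserted)] -/
def aW : W ⟶ X_quad := (⊤ : (𝔸(Fin 0; X_quad)).Opens).ι ≫ (𝔸(Fin 0; X_quad) ↘ X_quad)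

/-- `aW` is an isomorphism.
[cite: Hu2025, [Hu22] p.131 l.6–9; joint J1 = GAP-LEDGER-HU row HU-R01 (unrefereed preprints under adjudication, D-0012/D-0089 — kernel statement about OUR typed records; nothing of the sources asserted)] -/
instance isIso_aW : IsIso aW := by
  haveI : IsIso (⊤ : (𝔸(Fin 0; X_quad)).Opens).ι := inferInstanceAs (IsIso (𝔸(Fin 0; X_quad)).topIso.hom)
  unfold aW
  infer_instance

/-- `quot ≫ aW = quotX` (the record's `quot` is `quotX` followed by the identification isos).
[cite: Hu2025, [Hu22] p.131 l.10–16; joint J1 = GAP-LEDGER-HU row HU-R01 (unrefereed preprints under adjudication, D-0012/D-0089 — kernel statement about OUR typed records; nothing of the sources asserted)] -/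
theorem quot_aW : Sq.quot ≫ aW = quotX := by
  show (quotX ≫ inv (𝔸(Fin 0; X_quad) ↘ X_quad) ≫ (𝔸(Fin 0; X_quad)).topIso.inv) ≫
    ((⊤ : (𝔸(Fin 0; X_quad)).Opens).ι ≫ (𝔸(Fin 0; X_quad) ↘ X_quad)) = quotX
  simp only [Category.assoc]
  rw [Scheme.toIso_inv_ι_assoc, IsIso.inv_hom_id, Category.comp_id]

/-- `quot = quotX ≫ aW⁻¹`.
[cite: Hu2025, [Hu22] p.131 l.10–16; joint J1 = GAP-LEDGER-HU row HU-R01 (unrefereed preprints under adjudication, D-0012/D-0089 — kernel statement about OUR typed records; nothing of the sources asserted)] -/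
theorem quot_eq : Sq.quot = quotX ≫ inv aW := (IsIso.eq_comp_inv aW).mpr quot_aW

/-- `U|_⊤` as a scheme. OURS abbreviation.
[cite: Hu2025, [Hu22] p.132 l.43–51; joint J1 = GAP-LEDGER-HU row HU-R01 (unrefereed preprints under adjudication, D-0012/D-0089 — kernel statement about OUR typed records; nothing of the sources asserted)] -/
abbrev W' : Scheme.{0} := ((⊤ : W.Opens) : Scheme.{0})

/-- The identification `j : U|_⊤ ≅ X_quad`. OURS plumbing.
[cite: Hu2025, [Hu22] p.132 l.43–51; joint J1 = GAP-LEDGER-HU row HU-R01 (unrefereed preprints under adjudication, D-0012/D-0089 — kernel statement about OUR typed records; nothing of the sources asserted)] -/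
def jW : W' ≅ X_quad := W.topIso ≪≫ asIso aW

/-- `jW.hom = ι_⊤ ≫ aW`.
[cite: Hu2025, [Hu22] p.132 l.43–51; joint J1 = GAP-LEDGER-HU row HU-R01 (unrefereed preprints under adjudication, D-0012/D-0089 — kernel statement about OUR typed records; nothing of the sources asserted)] -/
theorem jW_hom : jW.hom = (⊤ : W.Opens).ι ≫ aW := rfl

/-- `specLaurentIso` for the slice (its source `Spec` of the Laurent ring in the `SplitTorus` spelling IS `laurentX`, definitionally)
over `X_quad`: `hom ≫ proj = laurentProj`.
[cite: Hu2025, [Hu22] p.132 l.43–51; joint J1 = GAP-LEDGER-HU row HU-R01 (unrefereed preprints under adjudication, D-0012/D-0089 — kernel statement about OUR typed records; nothing of the sources asserted)] -/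
theorem laurent_specLaurentIso_proj :
    (SplitTorus.specLaurentIso (CommRingCat.of SliceRing) 8 :
        laurentX ≅ ((splitTorusOver 8 X_quad : (𝔸(Fin 8; X_quad)).Opens) : Scheme.{0})).hom ≫
      splitTorusOverProj 8 X_quad = laurentProj :=
  SplitTorus.specLaurentIso_hom_proj (CommRingCat.of SliceRing) 8

/-- **The trivialisation `e : quot⁻¹(⊤) ≅ splitTorusOver 8 (U|_⊤)`** of the (β)-inhabitant (one open set). OURS.
[cite: Hu2025, Thm. 9.4 p.161; [Hu22] p.132 l.43–51 («(9.4) Gr_d|_O ≅ O × (𝔾ⁿ_m/𝔾_m)»); joint J1 = GAP-LEDGER-HU row HU-R01 (unrefereed preprints under adjudication, D-0012/D-0089 — kernel statement about OUR typed records of rows 101/110; nothing of the sources asserted)] -/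
def trivialisation : ((Sq.quot ⁻¹ᵁ (⊤ : W.Opens) : Lit.cellScheme.Opens) : Scheme.{0}) ≅
    ((splitTorusOver 8 W' : (𝔸(Fin 8; W')).Opens) : Scheme.{0}) :=
  Lit.cellScheme.topIso ≪≫ cellIsoLaurent ≪≫
    (SplitTorus.specLaurentIso (CommRingCat.of SliceRing) 8 :
      laurentX ≅ ((splitTorusOver 8 X_quad : (𝔸(Fin 8; X_quad)).Opens) : Scheme.{0})) ≪≫
    (SplitTorus.transport jW 8).symm

/-- **Compatibility: `e.hom ≫ proj = quot ∣_ ⊤`.**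
[cite: Hu2025, Thm. 9.4 p.161; [Hu22] p.132 l.43–51 («(9.4) Gr_d|_O ≅ O × (𝔾ⁿ_m/𝔾_m)»); joint J1 = GAP-LEDGER-HU row HU-R01 (unrefereed preprints under adjudication, D-0012/D-0089 — kernel statement about OUR typed records of rows 101/110; nothing of the sources asserted)] -/
theorem trivialisation_hom_proj :
    trivialisation.hom ≫ splitTorusOverProj 8 W' = Sq.quot ∣_ (⊤ : W.Opens) := by
  -- compare after composing with the monomorphism `ι_⊤ : U|_⊤ ⟶ U`
  rw [← cancel_mono (⊤ : W.Opens).ι]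
  have hR : Sq.quot ∣_ (⊤ : W.Opens) ≫ (⊤ : W.Opens).ι = (Sq.quot ⁻¹ᵁ (⊤ : W.Opens)).ι ≫ Sq.quot :=
    morphismRestrict_ι _ _
  -- `transport.symm.hom ≫ proj_{W'} ≫ ι_⊤ = proj_X ≫ aW⁻¹`
  have hT : (SplitTorus.transport jW 8).symm.hom ≫ splitTorusOverProj 8 W' ≫ (⊤ : W.Opens).ι =
      splitTorusOverProj 8 X_quad ≫ inv aW := by
    rw [Iso.symm_hom, Iso.inv_comp_eq, ← Category.assoc, SplitTorus.transport_hom_proj, jW_hom]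
    simp only [Category.assoc, IsIso.hom_inv_id, Category.comp_id]
  have h3 : (SplitTorus.specLaurentIso (CommRingCat.of SliceRing) 8 :
        laurentX ≅ ((splitTorusOver 8 X_quad : (𝔸(Fin 8; X_quad)).Opens) : Scheme.{0})).hom ≫
      splitTorusOverProj 8 X_quad ≫ inv aW = laurentProj ≫ inv aW := by
    rw [← Category.assoc]
    exact congrArg (fun x => x ≫ inv aW) laurent_specLaurentIso_proj
  have h4 : cellIsoLaurent.hom ≫ laurentProj ≫ inv aW = Sq.quot := by
    rw [← Category.assoc, cellIsoLaurent_hom_laurentProj, ← quot_eq]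
  have hL : trivialisation.hom ≫ splitTorusOverProj 8 W' ≫ (⊤ : W.Opens).ι = Lit.cellScheme.topIso.hom ≫ Sq.quot := by
    rw [trivialisation]
    simp only [Iso.trans_hom, Category.assoc]
    have e1 := congrArg (fun x => Lit.cellScheme.topIso.hom ≫ cellIsoLaurent.hom ≫
      (SplitTorus.specLaurentIso (CommRingCat.of SliceRing) 8 :
        laurentX ≅ ((splitTorusOver 8 X_quad : (𝔸(Fin 8; X_quad)).Opens) : Scheme.{0})).hom ≫ x) hT
    have e2 := congrArg (fun x => Lit.cellScheme.topIso.hom ≫ cellIsoLaurent.hom ≫ x) h3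
    have e3 := congrArg (fun x => Lit.cellScheme.topIso.hom ≫ x) h4
    exact e1.trans (e2.trans e3)
  have hfin : (Sq.quot ⁻¹ᵁ (⊤ : W.Opens)).ι ≫ Sq.quot = Lit.cellScheme.topIso.hom ≫ Sq.quot := rfl
  simp only [Category.assoc]
  exact hL.trans (hfin.symm.trans hR.symm)

/-- **MAIN (W11h): the (β)-inhabitant SATISFIES the printed trivialisation claim (9.4) as typed by row 110 g** —
`Hu22P132L30 S_quad_torus.toHu22Setup`: with the ONE-element open cover `{⊤}` of `U = X_quad`, `quot⁻¹(⊤) ≅ ⊤ × 𝔾⁸_m` over `⊤`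
(`splitTorusOver (9 − 1)`). For this datum «`π` is the quotient map of the free torus action, a (trivial) principal
`𝔾⁸_m`-bundle» thus holds in the record's own typed shape (torus free: `TorusFree.torusFreeOnCell_quadHuMatroid`). OURS kernel
statement; nothing of [Hu25]/[Hu22] asserted.
[cite: Hu2025, Thm. 9.4 p.161; [Hu22] p.132 l.30–51 («the quotient map π … is a principal (𝔾ⁿ_m/𝔾_m)-bundle … (9.4) Gr_d|_O ≅ O × (𝔾ⁿ_m/𝔾_m) … 𝔾^{n−1}_m»), p.131 l.6–16; joint J1 = GAP-LEDGER-HU row HU-R01, reading (β) of the LEAD INDEX RULING 2026-08-27T10:01:59Z (unrefereed preprints under adjudication, D-0012/D-0089 — kernel statement about OUR typed records of rows 101/110; nothing of the sources asserted)] -/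
theorem hu22P132L30_torus : Hu22P132L30 S_quad_torus.toHu22Setup :=
  ⟨Unit, inferInstance, fun _ => ⊤, iSup_const, fun _ => ⟨trivialisation, trivialisation_hom_proj⟩⟩

/-- **THE (β) BUNDLE, by one name** — there is an inhabitant `S` of row 110 f's `Hu22Setup_ours ℚ 9 d_quad` (namely
`S_quad_torus`: `X = U = Gr_d/(𝔾⁹_m/𝔾_m)` as the normal-form slice, `cell` = the Prop-9.1 locus, `quot` = the torus
normalisation) such that: `X` is INTEGRAL; the torus acts FREELY on the cell of `d_quad` (Thm 9.4 clause, row 110c reading); the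
printed trivialisation claim (9.4) `Hu22P132L30` HOLDS for it (so `quot` IS the quotient map of a trivial `𝔾⁸_m`-torsor: printed
(a) minus «positive integer `r`»); and BOTH typed readings of [Hu22] p.131 l.40–41 FAIL for it (`Z_{Γ_d}` is not integral). Every
field of row 110 h's `Hu22Setup_printed_ours` except `r_pos` is thereby met by name (with `isoBarGr` nominal, as h discloses).
OURS kernel statement about the typed records; it bears on the adjudication of ONE inference, not on [Hu25] Thm 1.3/1.1.
[cite: Hu2025, Thm. 9.4 p.161; [Hu22] p.131 l.4–41 (properties (a) l.6–16, (b) l.27–40, sentence l.40–41), p.132 l.30–51 ((9.4)); joint J1 = GAP-LEDGER-HU row HU-R01, reading (β) of the LEAD INDEX RULING 2026-08-27T10:01:59Z (unrefereed preprints under adjudication, D-0012/D-0089 — kernel statement about OUR typed records of rows 101/110; nothing of the sources asserted)] -/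
theorem beta_reading_bundle :
    ∃ S : Hu22Setup_ours ℚ 9 quadHuMatroid,
      IsIntegral S.X ∧ TorusFreeOnCell quadHuMatroid ∧ Hu22P132L30 S.toHu22Setup ∧
        ¬ Hu22P131L40 S.toHu22Setup ∧ ¬ Hu22P131L40_ours S :=
  ⟨S_quad_torus, isIntegral_X_quad, TorusFree.torusFreeOnCell_quadHuMatroid, hu22P132L30_torus, not_Hu22P131L40_torus,
    not_Hu22P131L40_ours_torus⟩

end Torus

end Literature.AlgebraicGeometry.Hu2025.Statements.S01S09Interface

end
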